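import Summits.QuantumFields.YangMills.Theorems.BalabanUVNodesN15KingModelProp37AtZeroField
import Summits.QuantumFields.YangMills.Theorems.BalabanUVNodesN15KingModelFullPropagatorRateProfile
import Summits.QuantumFields.YangMills.Theorems.BalabanUVNodesN15KingModelFullPropagatorGradRate
import HarnessLib

/-!
# BalabanUVNodes ∕ N15 — THE KING-MODEL RUNG, CURVED EDITION (PART Χ-a): THE TWO-SPACING DATUM OF KING 1986 PROPOSITION 3.9 **AT `A = 0`** —
# `kingSlicesTwoSpacing : SlicePropagator.TwoSpacing (d+1)`: the Prop.-3.7 data of the `k`-level and of the `(k+n)`-level `A = 0` runs over ONE unit cube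
# (part Ρ-e `kingSliceKernels`), paired by King's block map `x′ ↦ x`, the fine run's slices RE-INDEXED `j ↦ j + n` (King's «−n ≤ j ≤ k − 1»); the carrier
# bridges to parts F∕H∕M (`ksSlice′`, `ksDSlice′`) that carry the two-spacing rates (Track A, DAG node N15 = NE2; FAN-OUT v1.1 §N15 s3 «KING-MODEL RUNG»)

HONEST FRAMING.  Count-neutral (cell `pub-ymgap`, seat `pub-ymgap-dag-n15-e` g18; `--supports stmt-QuantumFields-27366 --as helper` = K3⁸
`SpineGivenEndpointR13SepCoPHV`).  TEMPLATE LITERATURE, `A = 0`: C. King's scalar U(1)-Higgs MODEL on finite tori ([King1986] (2.17) p. 653, (2.20) p. 654,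
p. 664 «When x′ ∈ T_{η′}, we denote by x that point in T_η for which x′ ∈ B^n(x)», Prop. 3.9 (3.73)–(3.75) p. 665 — PRINTED and proved there (§4,
(4.42)–(4.43) p. 675); here the DATA at `A = 0`, `Ω = T_η`), NOT Bałaban's covariant objects; NE2⁺ is NOT PRINTED for those and not proved; NOT a node
discharge; nothing continuum ∕ ℝ⁴ ∕ OS ∕ mass-gap ∕ Clay.  0 `sorry`; THREE plumbing `def`s (the pairing `kingSlicePt`, the re-indexed fine datum
`kingSliceKernelsHi`, ★ the `TwoSpacing` DATUM `kingSlicesTwoSpacing`) — definition lane; standard axioms.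

THE DATUM `kingSlicesTwoSpacing L k n e_M M a m²` (`TwoSpacing (d+1)`, [King1986] p. 664 ∕ Prop. 3.9): `lo :=` part Ρ-e's `kingSliceKernels L k e_M M a m²`
(the `k`-level run over the cube `M_ν = 2L^{e_M}`: sites `T_η = Tor (fine (L^k) M)`, `η = L^{−k}`, slices `G^η_{(j)}`, `0 ≤ j ≤ k − 1`); `hi := kingSliceKernelsHi`
= the SAME datum of the `(k+n)`-level run over the SAME unit cube (`T_{η′} = Tor (fine (L^{k+n}) M)`, `η′ = L^{−(k+n)}`) with its slice index SHIFTED,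
`hi.G j := G^{η′}_{(j+n)}` — the fine run's slice of physical length `L^{j+n}η′ = L^jη`, which is King's `G^{η′}_{(j)}` in the indexing «−n ≤ j ≤ k − 1» of
Prop. 3.7's «Furthermore» clause (p. 663) and of (3.73); `n`; `pt := kingSlicePt` (`x_μ = ⌊x′_μ∕L^n⌋`, King's `x′ ∈ B^n(x)`); `bd` on the empty bond sort
(`B = PEmpty`: (3.74)'s contour kernels are the VECTOR field's — EMPTY BY TYPE in the scalar model, said); Prop. 3.8's external-line fields
`K, dK, K′, dK′ := 0`, `IsUnit := True` — INERT: they are NOT read by `Prop39PrintedAt`∕`Prop39KingOrder`, and King's (3.71) objects at `A = 0` are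
dag-n15-d's `kingTwoSpacingH` (parts 51–54, `Prop38KingOrder` by name), not restated here.
THIS FILE (plumbing only; the lines (3.73)∕(3.75) and the by-name theorem are parts Χ-b∕Χ-c∕Χ-d): §1 transport lemmas (`torCongr_torCongr`,
`kingH_congrN`∕`dkingH_congrN`: the minimiser kernel does not see the spelling `L^nL^j` vs `L^{j+n}`; `ksSlice_reindex`∕`ksDSlice_reindex`: parts F∕H's
pieces read only the fields `e, j` of their index; ★ `ksSlice'_eq_ksSlice`∕`ksDSlice'_eq_ksDSlice`: the fine run's piece `ksSlice′` at index `(e, j, n)` IS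
the piece `ksSlice` at index `(e, j + n)`); §2 the pairing `kingSlicePt` and its geometry against `tdistT` (`mul_tdistT_kingSlicePt_le`,
`tdistT_le_mul_kingSlicePt`, continuum-unit forms); §3 the data + `rfl` reading lemmas.  The bridges to parts F∕H∕M at the two-spacing index
(`kingSliceG_lo_eq`∕`_hi_eq`, `kingSliceDG_lo_eq`∕`_hi_eq`, `kingSlicePt_bridge`) are the companion file `…SlicesTwoSpacingBridges` (part Χ-a₂).
HONEST SCOPE (the dictionary, as in part Ρ-e): King's normalisation `(L^jη)^{2−D}` and the (2.20) mass scaling are APPLIED as the definition of the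
level-`k` kernels (part K proves the one-step identity `ksSlice_eq_king`; the telescoped sum (2.17) on `T_η` is not re-proved).
WHAT THE CURVED CASE ADDS (one line): the same data for `G_(j)(Ω, A)`, regular `A ≠ 0` (Def. 3.2), `Ω ⊊ T_η`, with the contour clause — [King1986] §4.
Locators: [King1986] (2.17) p.653, (2.20) p.654, Prop. 3.7 p.663, p.664 (pairing), Prop. 3.9 (3.73)–(3.75) p.665, (4.42)–(4.43) p.675.
-/

noncomputable section

namespace Summit.QuantumFields.YangMills.BalabanUVNodes.N15KingModelRung.Curved

open Real Finset Matrix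
open Literature.MathematicalPhysics.QuantumFieldTheory.Balaban1983to89.B5Prop11Plancherel (Tor fine unitVec)
open Literature.MathematicalPhysics.QuantumFieldTheory.King1986 (aK)
open Literature.MathematicalPhysics.QuantumFieldTheory.King1986.Torus (blockOf tdistT tdistT_nonneg torCongr torCongr_add torCongr_unitVec
  tdistT_torCongr val_torCongr torCongr_refl)
open Literature.MathematicalPhysics.QuantumFieldTheory.King1986.SlicePropagator (SliceKernels TwoSpacing holderDeriv)

variable {d : ℕ} (L : ℕ) [NeZero L]

/-! ## §1 Transport plumbing: spellings of the periods and of the index -/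

section Transport

/-- Two period re-spellings compose to one. [folklore] -/
theorem torCongr_torCongr {dd : ℕ} {K K' K'' : Fin dd → ℕ} [∀ μ, NeZero (K'' μ)] (h₁ : ∀ μ, K μ = K' μ) (h₂ : ∀ μ, K' μ = K'' μ)
    (x : Tor K) : torCongr h₂ (torCongr h₁ x) = torCongr (fun μ => (h₁ μ).trans (h₂ μ)) x := by
  funext μ
  apply ZMod.val_injective
  rw [val_torCongr, val_torCongr, val_torCongr]

omit [NeZero L] in
/-- **King's minimiser kernel `ℋ_K` does not see the spelling of the number of fine points per block** (`N = N′` as numbers, e.g. `L^nL^j` vs `L^{j+n}`).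
[cite: King1986, (2.13)–(2.15) p.653, (2.20) p.654] -/
theorem kingH_congrN {N N' : ℕ} [NeZero N] [NeZero N'] (hN : N = N') (U : Fin (d + 1) → ℕ) [∀ μ, NeZero (U μ)]
    (h : ∀ μ, fine N U μ = fine N' U μ) (a m2 : ℝ) (K : ℕ) (z : Tor U) (x : Tor (fine N U)) :
    kingH L N' U a m2 K z (torCongr h x) = kingH L N U a m2 K z x := by
  subst hN
  rw [torCongr_refl]

omit [NeZero L] in
/-- … nor does its forward lattice derivative `∂^η_μℋ_K`. [cite: King1986, (2.13)–(2.15) p.653, (2.20) p.654] -/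
theorem dkingH_congrN {N N' : ℕ} [NeZero N] [NeZero N'] (hN : N = N') (U : Fin (d + 1) → ℕ) [∀ μ, NeZero (U μ)]
    (h : ∀ μ, fine N U μ = fine N' U μ) (a m2 : ℝ) (K : ℕ) (z : Tor U) (μ : Fin (d + 1)) (x : Tor (fine N U)) :
    dkingH L N' U a m2 K z μ (torCongr h x) = dkingH L N U a m2 K z μ x := by
  subst hN
  rw [torCongr_refl]

/-- **Part F's piece reads only the fields `e, j` of its index**: two indices with the same `e` and `j` give the same `ksSlice` (along the trivial
re-spelling of the carrier). [cite: King1986, (4.42) p.675] -/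
theorem ksSlice_reindex (a m2 : ℝ) {i₁ i₂ : KSliceIdx d} (he : i₁.e = i₂.e) (hj : i₁.j = i₂.j)
    (h : ∀ μ, fine (L ^ i₁.j) (ksU L i₁) μ = fine (L ^ i₂.j) (ksU L i₂) μ) (x y : Tor (fine (L ^ i₁.j) (ksU L i₁))) :
    ksSlice L a m2 i₂ (torCongr h x) (torCongr h y) = ksSlice L a m2 i₁ x y := by
  obtain ⟨e₁, j₁, p₁, n₁, q₁, m₁, r₁, M₁, s₁⟩ := i₁
  obtain ⟨e₂, j₂, p₂, n₂, q₂, m₂, r₂, M₂, s₂⟩ := i₂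
  dsimp only at he hj
  subst he hj
  have hx : torCongr h x = x := torCongr_refl h x
  have hy : torCongr h y = y := torCongr_refl h y
  rw [hx, hy]
  rfl

/-- The same for part H's gradient piece `ksDSlice`. [cite: King1986, (4.42) p.675] -/
theorem ksDSlice_reindex (a m2 : ℝ) {i₁ i₂ : KSliceIdx d} (he : i₁.e = i₂.e) (hj : i₁.j = i₂.j)
    (h : ∀ μ, fine (L ^ i₁.j) (ksU L i₁) μ = fine (L ^ i₂.j) (ksU L i₂) μ) (μ : Fin (d + 1))
    (x y : Tor (fine (L ^ i₁.j) (ksU L i₁))) :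
    ksDSlice L a m2 i₂ μ (torCongr h x) (torCongr h y) = ksDSlice L a m2 i₁ μ x y := by
  obtain ⟨e₁, j₁, p₁, n₁, q₁, m₁, r₁, M₁, s₁⟩ := i₁
  obtain ⟨e₂, j₂, p₂, n₂, q₂, m₂, r₂, M₂, s₂⟩ := i₂
  dsimp only at he hj
  subst he hj
  have hx : torCongr h x = x := torCongr_refl h x
  have hy : torCongr h y = y := torCongr_refl h y
  rw [hx, hy]
  rfl

/-- ★ **THE FINE RUN's PIECE AT INDEX `(e, j, n)` IS THE PIECE AT INDEX `(e, j + n)`**: `ksSlice′_{(e,j,n)}(x′, y′) = ksSlice_{(e,j+n)}(x′, y′)` along the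
re-spelling `L^nL^j = L^{j+n}` of the carrier — both are `Σ_w(Σ_z ℋ_{j+n}(x′, z)C^{(j+n)}(z, w))ℋ_{j+n}(y′, w)` over the unit lattice `2L^{e+1}`; i.e. the
fine run's slice of (3.73) IS the `(j+n)`-th slice (2.17) of that run (part K `ksSlice_eq_sub`: `= G′_{j+n+1} − G′_{j+n}`). [cite: King1986, (2.17) p.653, Prop. 3.7 p.663 («Furthermore … −n ≤ j ≤ k − 1»), (4.42) p.675] -/
theorem ksSlice'_eq_ksSlice (a m2 : ℝ) {i i₂ : KSliceIdx d} (he : i.e = i₂.e) (hj : i₂.j = i.j + i.n)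
    (h : ∀ μ, fine (L ^ i.n * L ^ i.j) (ksU L i) μ = fine (L ^ i₂.j) (ksU L i₂) μ)
    (x' y' : Tor (fine (L ^ i.n * L ^ i.j) (ksU L i))) :
    ksSlice L a m2 i₂ (torCongr h x') (torCongr h y') = ksSlice' L a m2 i x' y' := by
  obtain ⟨e, j, p, n, q, m, r, Ms, s⟩ := i
  obtain ⟨e₂, j₂, p₂, n₂, q₂, m₂, r₂, Ms₂, s₂⟩ := i₂
  dsimp only at he hj h x' y' ⊢
  subst he hj
  have hN : L ^ n * L ^ j = L ^ (j + n) := by rw [pow_add, mul_comm]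
  have hH : ∀ u : Tor (fine (L ^ n * L ^ j) (ksU L ⟨e, j, p, n, q, m, r, Ms, s⟩)),
      ksH L a m2 ⟨e, j + n, p₂, n₂, q₂, m₂, r₂, Ms₂, s₂⟩ (torCongr h u) = ksH' L a m2 ⟨e, j, p, n, q, m, r, Ms, s⟩ u := by
    intro u
    funext z
    exact kingH_congrN L hN (ksU L ⟨e, j, p, n, q, m, r, Ms, s⟩) h a m2 (j + n) z u
  unfold ksSlice ksSlice'
  rw [hH x', hH y']
  rfl

/-- ★ The same for the gradient pieces: `ksDSlice′_{(e,j,n)} = ksDSlice_{(e,j+n)}` along `L^nL^j = L^{j+n}`. [cite: King1986, (2.17) p.653, (4.42) p.675, Prop. 3.9 (3.73) p.665 (second line)] -/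
theorem ksDSlice'_eq_ksDSlice (a m2 : ℝ) {i i₂ : KSliceIdx d} (he : i.e = i₂.e) (hj : i₂.j = i.j + i.n)
    (h : ∀ μ, fine (L ^ i.n * L ^ i.j) (ksU L i) μ = fine (L ^ i₂.j) (ksU L i₂) μ) (μ : Fin (d + 1))
    (x' y' : Tor (fine (L ^ i.n * L ^ i.j) (ksU L i))) :
    ksDSlice L a m2 i₂ μ (torCongr h x') (torCongr h y') = ksDSlice' L a m2 i μ x' y' := by
  obtain ⟨e, j, p, n, q, m, r, Ms, s⟩ := i
  obtain ⟨e₂, j₂, p₂, n₂, q₂, m₂, r₂, Ms₂, s₂⟩ := i₂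
  dsimp only at he hj h x' y' ⊢
  subst he hj
  have hN : L ^ n * L ^ j = L ^ (j + n) := by rw [pow_add, mul_comm]
  have hH : ∀ u : Tor (fine (L ^ n * L ^ j) (ksU L ⟨e, j, p, n, q, m, r, Ms, s⟩)),
      ksH L a m2 ⟨e, j + n, p₂, n₂, q₂, m₂, r₂, Ms₂, s₂⟩ (torCongr h u) = ksH' L a m2 ⟨e, j, p, n, q, m, r, Ms, s⟩ u := by
    intro u
    funext z
    exact kingH_congrN L hN (ksU L ⟨e, j, p, n, q, m, r, Ms, s⟩) h a m2 (j + n) z u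
  have hD : ∀ u : Tor (fine (L ^ n * L ^ j) (ksU L ⟨e, j, p, n, q, m, r, Ms, s⟩)),
      ksDH L a m2 ⟨e, j + n, p₂, n₂, q₂, m₂, r₂, Ms₂, s₂⟩ μ (torCongr h u) = ksDH' L a m2 ⟨e, j, p, n, q, m, r, Ms, s⟩ μ u := by
    intro u
    funext z
    exact dkingH_congrN L hN (ksU L ⟨e, j, p, n, q, m, r, Ms, s⟩) h a m2 (j + n) z μ u
  unfold ksDSlice ksDSlice'
  rw [hD x', hH y']
  rfl

end Transport

/-! ## §2 King's pairing `x′ ↦ x` on the one carrier, and its geometry -/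

section Pairing

omit [NeZero L] in
/-- The period identity `L^{k+n}·M_ν = L^n·L^k·M_ν`. [cite: King1986, (2.20) p.654] -/
theorem carrier_pow_add (k n : ℕ) (M : Fin (d + 1) → ℕ) : ∀ μ, fine (L ^ (k + n)) M μ = fine (L ^ n * L ^ k) M μ := by
  intro μ
  show L ^ (k + n) * M μ = L ^ n * L ^ k * M μ
  rw [pow_add, mul_comm (L ^ k)]

/-- **KING's PAIRING MAP on the one carrier**: the point `x ∈ T_η = Tor (fine (L^k) M)` under `x′ ∈ T_{η′} = Tor (fine (L^{k+n}) M)`, `x_μ = ⌊x′_μ∕L^n⌋`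
— *"When x′ ∈ T_{η′}, we denote by x that point in T_η for which x′ ∈ B^n(x)"* (part C's `underPtN` along the spelling `L^{k+n} = L^nL^k`).
[cite: King1986, p.664 (before Prop. 3.8)] -/
def kingSlicePt (k n : ℕ) (M : Fin (d + 1) → ℕ) (x' : Tor (fine (L ^ (k + n)) M)) : Tor (fine (L ^ k) M) :=
  underPtN L k n M (torCongr (carrier_pow_add L k n M) x')

/-- Its coordinates: `x_μ = ⌊x′_μ∕L^n⌋`. [cite: King1986, p.664 (pairing)] -/
theorem val_kingSlicePt (k n : ℕ) (M : Fin (d + 1) → ℕ) [∀ μ, NeZero (M μ)] (x' : Tor (fine (L ^ (k + n)) M)) (μ : Fin (d + 1)) :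
    (kingSlicePt L k n M x' μ).val = (x' μ).val / L ^ n := by
  unfold kingSlicePt
  rw [val_underPtN, val_torCongr]

/-- **The pairing contracts fine distances by `L^n` up to a block diameter**: `L^n·|x − y|_{T_η} ≤ |x′ − y′|_{T_{η′}} + (L^n − 1)` (lattice units; part S-a
`mul_tdistT_underPtN_le`). [cite: King1986, p.664 (pairing), (2.10) p.653] -/
theorem mul_tdistT_kingSlicePt_le (k n : ℕ) (M : Fin (d + 1) → ℕ) [∀ μ, NeZero (M μ)] (x' y' : Tor (fine (L ^ (k + n)) M)) :
    ((L ^ n : ℕ) : ℝ) * tdistT (fine (L ^ k) M) (kingSlicePt L k n M x') (kingSlicePt L k n M y')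
      ≤ tdistT (fine (L ^ (k + n)) M) x' y' + (((L ^ n : ℕ) : ℝ) - 1) := by
  unfold kingSlicePt
  have h := mul_tdistT_underPtN_le L k n M (torCongr (carrier_pow_add L k n M) x') (torCongr (carrier_pow_add L k n M) y')
  rwa [tdistT_torCongr] at h

/-- **… and expands them by at most a block diameter**: `|x′ − y′|_{T_{η′}} ≤ L^n·|x − y|_{T_η} + (L^n − 1)` (part S-a `tdistT_le_mul_underPtN`).
[cite: King1986, p.664 (pairing), (2.10) p.653] -/
theorem tdistT_le_mul_kingSlicePt (k n : ℕ) (M : Fin (d + 1) → ℕ) [∀ μ, NeZero (M μ)] (x' y' : Tor (fine (L ^ (k + n)) M)) :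
    tdistT (fine (L ^ (k + n)) M) x' y'
      ≤ ((L ^ n : ℕ) : ℝ) * tdistT (fine (L ^ k) M) (kingSlicePt L k n M x') (kingSlicePt L k n M y') + (((L ^ n : ℕ) : ℝ) - 1) := by
  unfold kingSlicePt
  have h := tdistT_le_mul_underPtN L k n M (torCongr (carrier_pow_add L k n M) x') (torCongr (carrier_pow_add L k n M) y')
  rwa [tdistT_torCongr] at h

/-- **The pairing defect in continuum units is below one coarse spacing** (first direction): `|x − y|∕L^k ≤ |x′ − y′|∕L^{k+n} + η`, `η = L^{−k}`.
[cite: King1986, p.664 (pairing)] -/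
theorem dist_kingSlicePt_le (k n : ℕ) (M : Fin (d + 1) → ℕ) [∀ μ, NeZero (M μ)] (x' y' : Tor (fine (L ^ (k + n)) M)) :
    tdistT (fine (L ^ k) M) (kingSlicePt L k n M x') (kingSlicePt L k n M y') / (L : ℝ) ^ k
      ≤ tdistT (fine (L ^ (k + n)) M) x' y' / (L : ℝ) ^ (k + n) + 1 / (L : ℝ) ^ k := by
  have hL0 : (0 : ℝ) < L := by exact_mod_cast Nat.pos_of_ne_zero (NeZero.ne L)
  have hk : (0 : ℝ) < (L : ℝ) ^ k := pow_pos hL0 _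
  have hn : (0 : ℝ) < (L : ℝ) ^ n := pow_pos hL0 _
  have h := mul_tdistT_kingSlicePt_le L k n M x' y'
  push_cast at h
  have h2 : tdistT (fine (L ^ k) M) (kingSlicePt L k n M x') (kingSlicePt L k n M y')
      ≤ (tdistT (fine (L ^ (k + n)) M) x' y' + (L : ℝ) ^ n) / (L : ℝ) ^ n := by
    rw [le_div_iff₀ hn]; linarith
  have hkn : (0 : ℝ) < (L : ℝ) ^ (k + n) := pow_pos hL0 _
  have h3 : (L : ℝ) ^ n / (L : ℝ) ^ (k + n) = 1 / (L : ℝ) ^ k := by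
    rw [div_eq_div_iff hkn.ne' hk.ne']; ring
  calc tdistT (fine (L ^ k) M) (kingSlicePt L k n M x') (kingSlicePt L k n M y') / (L : ℝ) ^ k
      ≤ ((tdistT (fine (L ^ (k + n)) M) x' y' + (L : ℝ) ^ n) / (L : ℝ) ^ n) / (L : ℝ) ^ k :=
        div_le_div_of_nonneg_right h2 hk.le
    _ = tdistT (fine (L ^ (k + n)) M) x' y' / (L : ℝ) ^ (k + n) + 1 / (L : ℝ) ^ k := by
        rw [div_div, mul_comm ((L : ℝ) ^ n) ((L : ℝ) ^ k), ← pow_add (L : ℝ) k n, add_div, h3]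

/-- **… (second direction)**: `|x′ − y′|∕L^{k+n} ≤ |x − y|∕L^k + η`. [cite: King1986, p.664 (pairing)] -/
theorem dist_le_kingSlicePt (k n : ℕ) (M : Fin (d + 1) → ℕ) [∀ μ, NeZero (M μ)] (x' y' : Tor (fine (L ^ (k + n)) M)) :
    tdistT (fine (L ^ (k + n)) M) x' y' / (L : ℝ) ^ (k + n)
      ≤ tdistT (fine (L ^ k) M) (kingSlicePt L k n M x') (kingSlicePt L k n M y') / (L : ℝ) ^ k + 1 / (L : ℝ) ^ k := by
  have hL0 : (0 : ℝ) < L := by exact_mod_cast Nat.pos_of_ne_zero (NeZero.ne L)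
  have hk : (0 : ℝ) < (L : ℝ) ^ k := pow_pos hL0 _
  have hn : (0 : ℝ) < (L : ℝ) ^ n := pow_pos hL0 _
  have hkn : (0 : ℝ) < (L : ℝ) ^ (k + n) := pow_pos hL0 _
  have h := tdistT_le_mul_kingSlicePt L k n M x' y'
  push_cast at h
  calc tdistT (fine (L ^ (k + n)) M) x' y' / (L : ℝ) ^ (k + n)
      ≤ ((L : ℝ) ^ n * (tdistT (fine (L ^ k) M) (kingSlicePt L k n M x') (kingSlicePt L k n M y') + 1)) / (L : ℝ) ^ (k + n) :=
        div_le_div_of_nonneg_right (by nlinarith) hkn.le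
    _ = tdistT (fine (L ^ k) M) (kingSlicePt L k n M x') (kingSlicePt L k n M y') / (L : ℝ) ^ k + 1 / (L : ℝ) ^ k := by
        rw [pow_add (L : ℝ) k n, mul_comm ((L : ℝ) ^ k) ((L : ℝ) ^ n), mul_div_mul_left _ _ hn.ne', add_div]

/-- **Distinct coarse points are at least one coarse spacing apart**: `0 < |x − y|∕L^k ⟹ η ≤ |x − y|∕L^k` (the torus distance is a natural number).
[folklore] -/
theorem eta_le_dist_of_pos {K : Fin (d + 1) → ℕ} [∀ μ, NeZero (K μ)] {N : ℝ} (hN : 0 < N) (x y : Tor K)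
    (hpos : 0 < tdistT K x y / N) : 1 / N ≤ tdistT K x y / N := by
  obtain ⟨m, hm⟩ := exists_natCast_eq_tdistT K x y
  rw [hm] at hpos ⊢
  have hm0 : m ≠ 0 := by
    rintro rfl
    simp at hpos
  have hm1 : (1 : ℝ) ≤ m := by exact_mod_cast Nat.one_le_iff_ne_zero.mpr hm0
  exact div_le_div_of_nonneg_right hm1 hN.le

end Pairing

/-! ## §3 The data -/

section Data

variable {L}

omit [NeZero L] in
/-- `1 ≤ k ⟹ 1 ≤ k + n`. [folklore] -/
theorem one_le_add_of_one_le {k : ℕ} (hk : 1 ≤ k) (n : ℕ) : 1 ≤ k + n := hk.trans (Nat.le_add_right k n)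

variable (L)

/-- **THE FINE RUN's DATUM, RE-INDEXED**: the Prop.-3.7 datum `kingSliceKernels L (k+n) e_M M a m²` of the `(k+n)`-level `A = 0` run over the cube
`M_ν = 2L^{e_M}` (sites `T_{η′} = Tor (fine (L^{k+n}) M)`, distance `|x′ − y′|∕L^{k+n}`) with its slice index SHIFTED by `n`: `G j := G^{η′}_{(j+n)}`,
`dG j := ∂^{η′}G^{η′}_{(j+n)}` — King's `G^{η′}_{(j)}` in the indexing «−n ≤ j ≤ k − 1» (the slice of length `L^jη`). [cite: King1986, Prop. 3.7 p.663 («Furthermore, if we replace G^η_{(j)} by G^{η′}_{(j)} … the bounds are valid for −n ≤ j ≤ k − 1»), Prop. 3.9 (3.73) p.665] -/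
def kingSliceKernelsHi (k n eM : ℕ) (M : Fin (d + 1) → ℕ) [∀ μ, NeZero (M μ)] (hM : ∀ μ, M μ = 2 * L ^ eM) (hk : 1 ≤ k) (a msq : ℝ) :
    SliceKernels (d + 1) :=
  { kingSliceKernels L (k + n) eM M hM (one_le_add_of_one_le hk n) a msq with
    G := fun j => (kingSliceKernels L (k + n) eM M hM (one_le_add_of_one_le hk n) a msq).G (j + n)
    dG := fun j => (kingSliceKernels L (k + n) eM M hM (one_le_add_of_one_le hk n) a msq).dG (j + n) }

/-- ★ **THE TWO-SPACING DATUM OF PROPOSITION 3.9 AT `A = 0`** (module docstring): `lo` = the `k`-level run's Prop.-3.7 datum, `hi` = the `(k+n)`-level run's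
(re-indexed), King's pairing `x′ ↦ x`; the bond map on the EMPTY bond sort; Prop. 3.8's external-line fields INERT (`0`, `True`) — not read by Prop. 3.9.
[cite: King1986, p.664 (two spacings, pairing), Prop. 3.9 (3.73)–(3.75) p.665] -/
def kingSlicesTwoSpacing (k n eM : ℕ) (M : Fin (d + 1) → ℕ) [∀ μ, NeZero (M μ)] (hM : ∀ μ, M μ = 2 * L ^ eM) (hk : 1 ≤ k) (a msq : ℝ) :
    TwoSpacing (d + 1) where
  lo := kingSliceKernels L k eM M hM hk a msq
  hi := kingSliceKernelsHi L k n eM M hM hk a msq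
  n := n
  k_hi := rfl
  L_hi := rfl
  pt := kingSlicePt L k n M
  bd := fun b => nomatch b
  IsUnit := fun _ => True
  K := fun _ _ => 0
  dK := fun _ _ _ => 0
  K' := fun _ _ => 0
  dK' := fun _ _ _ => 0

variable {L} {k n eM : ℕ} (M : Fin (d + 1) → ℕ) [∀ μ, NeZero (M μ)] (hM : ∀ μ, M μ = 2 * L ^ eM) (hk : 1 ≤ k) (a msq : ℝ)

/-- Reading: the coarse datum. [folklore] -/
theorem kingSlicesTwoSpacing_lo : (kingSlicesTwoSpacing L k n eM M hM hk a msq).lo = kingSliceKernels L k eM M hM hk a msq := rfl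

/-- Reading: the coarse block factor and level. [folklore] -/
theorem kingSlicesTwoSpacing_loL : (kingSlicesTwoSpacing L k n eM M hM hk a msq).lo.L = L := rfl

/-- Reading: the coarse level. [folklore] -/
theorem kingSlicesTwoSpacing_lok : (kingSlicesTwoSpacing L k n eM M hM hk a msq).lo.k = k := rfl

/-- Reading: the coarse kernels. [folklore] -/
theorem kingSlicesTwoSpacing_loG (j : ℕ) (x y : Tor (fine (L ^ k) M)) :
    (kingSlicesTwoSpacing L k n eM M hM hk a msq).lo.G j x y = kingSliceG L k eM M hM hk a msq j x y := rfl

/-- Reading: the coarse gradient kernels. [folklore] -/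
theorem kingSlicesTwoSpacing_lodG (j : ℕ) (μ : Fin (d + 1)) (x y : Tor (fine (L ^ k) M)) :
    (kingSlicesTwoSpacing L k n eM M hM hk a msq).lo.dG j μ x y = (kingSliceKernels L k eM M hM hk a msq).dG j μ x y := rfl

/-- Reading: the pairing. [folklore] -/
theorem kingSlicesTwoSpacing_pt (x' : Tor (fine (L ^ (k + n)) M)) : (kingSlicesTwoSpacing L k n eM M hM hk a msq).pt x' = kingSlicePt L k n M x' := rfl

/-- Reading: the fine kernels are the `(k+n)`-run's slices `j + n`. [cite: King1986, Prop. 3.9 (3.73) p.665] -/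
theorem kingSlicesTwoSpacing_hiG (j : ℕ) (x' y' : Tor (fine (L ^ (k + n)) M)) :
    (kingSlicesTwoSpacing L k n eM M hM hk a msq).hi.G j x' y' = kingSliceG L (k + n) eM M hM (one_le_add_of_one_le hk n) a msq (j + n) x' y' := rfl

/-- Reading: the fine gradient kernels. [cite: King1986, Prop. 3.9 (3.73) p.665] -/
theorem kingSlicesTwoSpacing_hidG (j : ℕ) (μ : Fin (d + 1)) (x' y' : Tor (fine (L ^ (k + n)) M)) :
    (kingSlicesTwoSpacing L k n eM M hM hk a msq).hi.dG j μ x' y'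
      = (L : ℝ) ^ (k + n) * (kingSliceG L (k + n) eM M hM (one_le_add_of_one_le hk n) a msq (j + n) (x' + unitVec (fine (L ^ (k + n)) M) μ) y'
          - kingSliceG L (k + n) eM M hM (one_le_add_of_one_le hk n) a msq (j + n) x' y') := rfl

/-- Reading: the fine distance `|x′ − y′|∕L^{k+n}`. [folklore] -/
theorem kingSlicesTwoSpacing_hidist (x' y' : Tor (fine (L ^ (k + n)) M)) :
    (kingSlicesTwoSpacing L k n eM M hM hk a msq).hi.dist x' y' = tdistT (fine (L ^ (k + n)) M) x' y' / (L : ℝ) ^ (k + n) := rfl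

/-- Reading: the coarse distance `|x − y|∕L^k`. [folklore] -/
theorem kingSlicesTwoSpacing_lodist (x y : Tor (fine (L ^ k) M)) :
    (kingSlicesTwoSpacing L k n eM M hM hk a msq).lo.dist x y = tdistT (fine (L ^ k) M) x y / (L : ℝ) ^ k := rfl

/-- Reading: the coarse distance at paired points. [folklore] -/
theorem kingSlicesTwoSpacing_lodist_pt (x' y' : Tor (fine (L ^ (k + n)) M)) :
    (kingSlicesTwoSpacing L k n eM M hM hk a msq).lo.dist ((kingSlicesTwoSpacing L k n eM M hM hk a msq).pt x')
        ((kingSlicesTwoSpacing L k n eM M hM hk a msq).pt y')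
      = tdistT (fine (L ^ k) M) (kingSlicePt L k n M x') (kingSlicePt L k n M y') / (L : ℝ) ^ k := rfl

/-- Reading: the coarse slice lengths `L^jη = L^j∕L^k`. [cite: King1986, (3.63) p.663] -/
theorem kingSlicesTwoSpacing_slice (j : ℕ) : (kingSlicesTwoSpacing L k n eM M hM hk a msq).lo.slice j = (L : ℝ) ^ j / (L : ℝ) ^ k :=
  kingSliceKernels_slice M hM hk a msq j

end Data

end Summit.QuantumFields.YangMills.BalabanUVNodes.N15KingModelRung.Curved

end
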